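import Summits.RiemannHypothesis.RiemannHypothesis.Theorems.WeilFormatCCinfCouplingOdd
import Summits.RiemannHypothesis.RiemannHypothesis.Theorems.WeilFormatCDeflatedFarDoorB
import Summits.RiemannHypothesis.RiemannHypothesis.Theorems.WeilFormatCDeflatedFarFreeMap
import Summits.RiemannHypothesis.RiemannHypothesis.Theorems.WeilDetectionPhase
import HarnessLib

/-!
# Format C, design C∞: the FRONT DOOR for polynomial profiles from collected monomial data (`WeilPositivityOn a`)

Route context: Fourier–Galerkin / Schur-complement certificates of Weil positivity on a window ("format C", C∞ door;
cell memo `run/shared/lean/pub/rh-explicit/rh-explicit-weil-10/KERNEL-LEVER.md` §21; supporting stmt-RiemannHypothesis-0098;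
seat rh-explicit-weil-10).  `weilPositivityOn_of_formatC_cinfBA` (DoorB with the certified prime constant) composed with
the kit theorems `cinf_hUq_even` / `cinf_hUq_odd`: for POLYNOMIAL profiles
`fe_j = Σ_{q∈se} c⁺_{jq} x^q` (even powers, `Σ_q c⁺_{jq} q a^{q−1} = 0`) and `fo_j = Σ_{q∈so} c⁻_{jq} x^q` (odd powers,
`Σ_q c⁻_{jq} a^q = 0`) and MATRIX free maps, `WeilPositivityOn a` follows from

* the certified prime constant `A` (`hPA`, K3 cells) and the far diagonals `d̂ ≤ d̂_A` with floors;
* per sector, the COLLECTED monomial data of the far coupling column (rows `n ≤ B`, images `q ∈ s`, profile table —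
  discharged by `abs_evenRow/oddRow_sub_family_le`, `abs_re/im_image_pow_sub_family_le` + `abs_sub_collected_scale`,
  `evenVTable_family`/`oddVTable_family`), the exact middle range `Ufin`, the weight energy `W`
  (`sum_Ico_weight_sq_le`), a family Gram majorant `Γ` (`sum_Ico_sq_sum_mul_le_of_boxes_fintype`), `θ > 0`, and ANY
  `Uq` dominating the resulting explicit majorant (`hUqe'`/`hUqo'`);
* per sector, the margin `hS` (PSD with margin of the augmented block minus `Uq` plus the free-map term) — verbatim
  DoorB.

The profile regularity/parity/boundary hypotheses of DoorB are discharged here from the coefficient conditions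
(`poly_contDiff`, `poly_hasDerivAt`, `deriv_poly_even_boundary`, `poly_odd_apply_self`); the `ℓ¹` bound of the matrix free
map is `sum_abs_matrixMap_le`.  Pure assembly; standard axioms; no definitions; no RH claim.
-/

set_option autoImplicit false
-- `Summit.RiemannHypothesis.RiemannHypothesis.…` is the layout-mandated namespace (summit = problem name).
set_option linter.dupNamespace false

noncomputable section

open Complex Filter Set MeasureTheory Finset
open scoped Real Topology ComplexConjugate

namespace Summit.RiemannHypothesis.RiemannHypothesis.Theorems.WeilFormatC

open Literature.NumberTheory.LFunctions Literature.NumberTheory.LFunctions.Yoshida1992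
  Literature.Analysis.SpecialFunctions

variable {a : ℝ}

/-! ## Polynomial profiles: regularity and boundary data -/

/-- A polynomial window profile is `C³`. -/
theorem poly_contDiff (s : Finset ℕ) (c : ℕ → ℝ) :
    ContDiff ℝ 3 (fun x : ℝ ↦ ∑ q ∈ s, ((c q : ℝ) : ℂ) * ((x : ℂ)) ^ q) := by
  have h1 : ContDiff ℝ 3 (fun x : ℝ ↦ (x : ℂ)) := (Complex.ofRealCLM : ℝ →L[ℝ] ℂ).contDiff
  exact ContDiff.sum fun q _ ↦ (contDiff_const : ContDiff ℝ 3 (fun _ : ℝ ↦ ((c q : ℝ) : ℂ))).mul (h1.pow q)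

/-- The derivative of a polynomial window profile. -/
theorem poly_hasDerivAt (s : Finset ℕ) (c : ℕ → ℝ) (x₀ : ℝ) :
    HasDerivAt (fun x : ℝ ↦ ∑ q ∈ s, ((c q : ℝ) : ℂ) * ((x : ℂ)) ^ q)
      (∑ q ∈ s, ((c q : ℝ) : ℂ) * ((q : ℂ) * ((x₀ : ℂ)) ^ (q - 1))) x₀ := by
  have h : ∀ q ∈ s, HasDerivAt (fun x : ℝ ↦ ((c q : ℝ) : ℂ) * ((x : ℂ)) ^ q)
      (((c q : ℝ) : ℂ) * ((q : ℂ) * ((x₀ : ℂ)) ^ (q - 1))) x₀ :=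
    fun q _ ↦ ((hasDerivAt_pow q (x₀ : ℂ)).comp_ofReal).const_mul _
  exact HasDerivAt.fun_sum h

/-- **Boundary data of an even polynomial profile**: with even powers and `Σ_q c_q q a^{q−1} = 0`,
`f′(−a) = f′(a)` (both vanish). -/
theorem deriv_poly_even_boundary (a : ℝ) (s : Finset ℕ) (c : ℕ → ℝ) (hs : ∀ q ∈ s, Even q)
    (hb : ∑ q ∈ s, c q * q * a ^ (q - 1) = 0) :
    deriv (fun x : ℝ ↦ ∑ q ∈ s, ((c q : ℝ) : ℂ) * ((x : ℂ)) ^ q) (-a)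
      = deriv (fun x : ℝ ↦ ∑ q ∈ s, ((c q : ℝ) : ℂ) * ((x : ℂ)) ^ q) a := by
  have ha : deriv (fun x : ℝ ↦ ∑ q ∈ s, ((c q : ℝ) : ℂ) * ((x : ℂ)) ^ q) a = 0 := by
    rw [(poly_hasDerivAt s c a).deriv]
    have e : ∑ q ∈ s, ((c q : ℝ) : ℂ) * ((q : ℂ) * ((a : ℂ)) ^ (q - 1))
        = (((∑ q ∈ s, c q * q * a ^ (q - 1) : ℝ)) : ℂ) := by
      push_cast
      exact Finset.sum_congr rfl fun q _ ↦ by ring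
    rw [e, hb, Complex.ofReal_zero]
  rw [WeilConverseWindow.deriv_neg_of_even (poly_even_real s c hs).1 a, ha, neg_zero]

/-- **Right end point of an odd polynomial profile**: `Σ_q c_q a^q = 0` gives `f(a) = 0`. -/
theorem poly_odd_apply_self (a : ℝ) (s : Finset ℕ) (c : ℕ → ℝ) (hb : ∑ q ∈ s, c q * a ^ q = 0) :
    (fun x : ℝ ↦ ∑ q ∈ s, ((c q : ℝ) : ℂ) * ((x : ℂ)) ^ q) a = 0 := by
  show ∑ q ∈ s, ((c q : ℝ) : ℂ) * ((a : ℂ)) ^ q = 0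
  have e : ∑ q ∈ s, ((c q : ℝ) : ℂ) * ((a : ℂ)) ^ q = (((∑ q ∈ s, c q * a ^ q : ℝ)) : ℂ) := by push_cast; rfl
  rw [e, hb, Complex.ofReal_zero]

/-! ## The front door -/

/-- **Weil positivity on `[−a, a]` from the C∞ door with polynomial profiles and collected monomial data.**
See the module docstring: DoorB (`weilPositivityOn_of_formatC_cinfBA`) with the coupling majorants of both sectors
produced by `cinf_hUq_even` / `cinf_hUq_odd` (any `Uq` dominating them), matrix free maps, and the margins `hS` verbatim. -/
theorem weilPositivityOn_of_cinf_poly (ha : 0 < a)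
    {A : ℝ} (hPA : ∀ (s : Finset ℤ) (c : ℤ → ℂ),
      -(A * ∑ n ∈ s, ‖c n‖ ^ 2) ≤ ∑ n ∈ s, ∑ m ∈ s, (conj (c n) * c m).re * primeCoeff a n m)
    -- ===== EVEN sector =====
    {Be re m₀e : ℕ} (hBe : 1 ≤ Be) (hBme : Be < m₀e) (se : Finset ℕ) (hse : ∀ q ∈ se, Even q)
    (coefe : Fin re → ℕ → ℝ) (hbe : ∀ j, ∑ q ∈ se, coefe j q * q * a ^ (q - 1) = 0)
    -- far diagonal: floor on [Be+1, ∞), floor on [m₀e, ∞), and `d̂ ≤ d̂_A`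
    (de : ℕ → ℝ) {d₀e d₁e : ℝ} (hde₀ : 0 < d₀e) (hde : ∀ m, Be + 1 ≤ m → d₀e ≤ de m)
    (hde₁ : 0 < d₁e) (hde₃ : ∀ m, m₀e ≤ m → d₁e ≤ de m)
    (hdle : ∀ m : ℕ, Be + 1 ≤ m → de m ≤
      (reDigammaQuarter (freq a m) - Real.log π) / 2 - a * (1 + weilArchDensity (2 * a)) / (π ^ 2 * m ^ 2)
        - 1 / (8 * m) - a * (1 + weilArchDensity (2 * a)) / π ^ 2 * Real.sqrt (8 / ((Be + 1 - 1 : ℕ) : ℝ)) - A / 2)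
    -- matrix free map
    (Λ1e : Fin re → Fin (Be + 1) → ℝ) (Λ2e : Fin re → Fin re → ℝ)
    -- collected monomial data on [m₀e, ∞)
    {ιe : Type*} [Fintype ιe] (φe : ιe → ℕ → ℝ) (we : ℕ → ℝ)
    (Prowe : ℕ → ιe → ℝ) (ρrowe : ℕ → ℝ) (hρrowe : ∀ n, 0 ≤ ρrowe n)
    (hrowe : ∀ m, m₀e ≤ m → ∀ n, n ≤ Be →
      |(if n = 0 then gramCoeff a 0 m else if m = 0 then gramCoeff a n 0
          else (gramCoeff a n m + gramCoeff a n (-(m : ℤ))) / 2)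
        - (-1 : ℝ) ^ m * ∑ f, Prowe n f * φe f m| ≤ ρrowe n * we m)
    (Pimge : ℕ → ιe → ℝ) (ρimge : ℕ → ℝ) (hρimge : ∀ q, 0 ≤ ρimge q)
    (himge : ∀ m, m₀e ≤ m → ∀ q ∈ se,
      |(weilWindowSesq a ((Icc (-a) a).indicator fun x : ℝ ↦ ((x : ℂ)) ^ q) (chi a m)).re
        - (-1 : ℝ) ^ m * ∑ f, Pimge q f * φe f m| ≤ ρimge q * we m)
    (Rtabe : Fin re → ιe → ℝ)
    (hVe : ∀ m, m₀e ≤ m → ∀ j : Fin re,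
      ((if m = 0 then 1 else 2) * (Yoshida1992.fourierCoeff a m ((Icc (-a) a).indicator fun x : ℝ ↦ ∑ q ∈ se, ((coefe j q : ℝ) : ℂ) * ((x : ℂ)) ^ q)).re / Real.sqrt (2 * a)) = (-1 : ℝ) ^ m * ∑ f, Rtabe j f * φe f m)
    -- exact middle range, weights, family Gram, θ, and a dominating Uq
    (Ufine : (Fin (Be + 1) → ℝ) → (Fin re → ℝ) → ℝ)
    (hfine : ∀ (x : Fin (Be + 1) → ℝ) (β : Fin re → ℝ),
      ∑ m ∈ Ico (Be + 1) m₀e,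
        (∑ i : Fin (Be + 1), (if (i : ℕ) = 0 then gramCoeff a 0 m else if m = 0 then gramCoeff a i 0
            else (gramCoeff a i m + gramCoeff a i (-(m : ℤ))) / 2) * x i
          + ∑ j, ((weilWindowSesq a ((Icc (-a) a).indicator (fun x : ℝ ↦ ∑ q ∈ se, ((coefe j q : ℝ) : ℂ) * ((x : ℂ)) ^ q)
              - proj a Be ((Icc (-a) a).indicator fun x : ℝ ↦ ∑ q ∈ se, ((coefe j q : ℝ) : ℂ) * ((x : ℂ)) ^ q))
              (chiEven a m)).re / (if m = 0 then 1 else Real.sqrt 2)) * β j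
          - ∑ j, ((if m = 0 then 1 else 2) * (Yoshida1992.fourierCoeff a m ((Icc (-a) a).indicator fun x : ℝ ↦ ∑ q ∈ se, ((coefe j q : ℝ) : ℂ) * ((x : ℂ)) ^ q)).re / Real.sqrt (2 * a))
              * (∑ i, Λ1e j i * x i + ∑ j', Λ2e j j' * β j')) ^ 2 / de m ≤ Ufine x β)
    {We : ℝ} (hWe : ∀ N, ∑ m ∈ Ico m₀e N, we m ^ 2 ≤ We)
    (Γe : (ιe → ℝ) → ℝ) (hΓe : ∀ (N : ℕ) (u : ιe → ℝ), ∑ m ∈ Ico m₀e N, (∑ f, u f * φe f m) ^ 2 ≤ Γe u)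
    {θe : ℝ} (hθe : 0 < θe)
    (Uqe : (Fin (Be + 1) → ℝ) → (Fin re → ℝ) → ℝ)
    (hUqe' : ∀ (x : Fin (Be + 1) → ℝ) (β : Fin re → ℝ),
      Ufine x β + ((1 + θe) * Γe (fun f ↦ ∑ i : Fin (Be + 1), (Prowe i f - ∑ j, Rtabe j f * Λ1e j i) * x i
            + ∑ j', ((∑ q ∈ se, coefe j' q * Pimge q f
                      - ∑ n ∈ Finset.range (Be + 1), ((if n = 0 then 1 else 2) * (Yoshida1992.fourierCoeff a n ((Icc (-a) a).indicator fun x : ℝ ↦ ∑ q ∈ se, ((coefe j' q : ℝ) : ℂ) * ((x : ℂ)) ^ q)).re / Real.sqrt (2 * a)) * Prowe n f)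
                    - ∑ j, Rtabe j f * Λ2e j j') * β j')
          + (1 + 1 / θe) * (We * ((∑ i : Fin (Be + 1), ρrowe i
                + ∑ j, (∑ q ∈ se, |coefe j q| * ρimge q
                    + ∑ n ∈ Finset.range (Be + 1), |((if n = 0 then 1 else 2) * (Yoshida1992.fourierCoeff a n ((Icc (-a) a).indicator fun x : ℝ ↦ ∑ q ∈ se, ((coefe j q : ℝ) : ℂ) * ((x : ℂ)) ^ q)).re / Real.sqrt (2 * a))| * ρrowe n))
              * (∑ i : Fin (Be + 1), ρrowe i * x i ^ 2
                + ∑ j, (∑ q ∈ se, |coefe j q| * ρimge q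
                    + ∑ n ∈ Finset.range (Be + 1), |((if n = 0 then 1 else 2) * (Yoshida1992.fourierCoeff a n ((Icc (-a) a).indicator fun x : ℝ ↦ ∑ q ∈ se, ((coefe j q : ℝ) : ℂ) * ((x : ℂ)) ^ q)).re / Real.sqrt (2 * a))| * ρrowe n) * β j ^ 2)))) / d₁e
        ≤ Uqe x β)
    -- margin (verbatim DoorB)
    {δe : ℝ} (hδe : 0 < δe)
    (hSe : ∀ (x : Fin (Be + 1) → ℝ) (β : Fin re → ℝ),
      δe * (∑ i, x i ^ 2 + ∑ j, β j ^ 2) ≤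
        ((∑ i : Fin (Be + 1), ∑ i' : Fin (Be + 1), x i * x i' *
            (if (i : ℕ) = 0 then gramCoeff a 0 i' else if (i' : ℕ) = 0 then gramCoeff a i 0
              else (gramCoeff a i i' + gramCoeff a i (-(i' : ℤ))) / 2))
          + 2 * (∑ i : Fin (Be + 1), ∑ j : Fin re, x i * β j *
            ((weilWindowSesq a ((Icc (-a) a).indicator (fun x : ℝ ↦ ∑ q ∈ se, ((coefe j q : ℝ) : ℂ) * ((x : ℂ)) ^ q)
              - proj a Be ((Icc (-a) a).indicator fun x : ℝ ↦ ∑ q ∈ se, ((coefe j q : ℝ) : ℂ) * ((x : ℂ)) ^ q))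
              (chiEven a i)).re / (if (i : ℕ) = 0 then 1 else Real.sqrt 2)))
          + (∑ j : Fin re, ∑ j' : Fin re, β j * β j' *
            (weilWindowSesq a ((Icc (-a) a).indicator (fun x : ℝ ↦ ∑ q ∈ se, ((coefe j q : ℝ) : ℂ) * ((x : ℂ)) ^ q)
                - proj a Be ((Icc (-a) a).indicator fun x : ℝ ↦ ∑ q ∈ se, ((coefe j q : ℝ) : ℂ) * ((x : ℂ)) ^ q))
              ((Icc (-a) a).indicator (fun x : ℝ ↦ ∑ q ∈ se, ((coefe j' q : ℝ) : ℂ) * ((x : ℂ)) ^ q)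
                - proj a Be ((Icc (-a) a).indicator fun x : ℝ ↦ ∑ q ∈ se, ((coefe j' q : ℝ) : ℂ) * ((x : ℂ)) ^ q))).re))
        - Uqe x β
        + 2 * ∑ j, (∑ i, Λ1e j i * x i + ∑ j', Λ2e j j' * β j') * (β j - ∑ j', (∑' n : ℕ, if Be + 1 ≤ n then
                ((if n = 0 then 1 else 2) * (Yoshida1992.fourierCoeff a n ((Icc (-a) a).indicator fun x : ℝ ↦ ∑ q ∈ se, ((coefe j q : ℝ) : ℂ) * ((x : ℂ)) ^ q)).re / Real.sqrt (2 * a)) *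
                ((if n = 0 then 1 else 2) * (Yoshida1992.fourierCoeff a n ((Icc (-a) a).indicator fun x : ℝ ↦ ∑ q ∈ se, ((coefe j' q : ℝ) : ℂ) * ((x : ℂ)) ^ q)).re / Real.sqrt (2 * a)) else 0) * β j'))
    -- ===== ODD sector =====
    {Bo ro m₀o : ℕ} (hBo : 1 ≤ Bo) (hBmo : Bo ≤ m₀o) (so : Finset ℕ) (hso : ∀ q ∈ so, Odd q)
    (coefo : Fin ro → ℕ → ℝ) (hbo : ∀ j, ∑ q ∈ so, coefo j q * a ^ q = 0)
    (dod : ℕ → ℝ) {d₀o d₁o : ℝ} (hdo₀ : 0 < d₀o) (hdo : ∀ m, Bo ≤ m → d₀o ≤ dod m)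
    (hdo₁ : 0 < d₁o) (hdo₃ : ∀ m, m₀o ≤ m → d₁o ≤ dod m)
    (hdlo : ∀ k : ℕ, Bo ≤ k → dod k ≤
      (reDigammaQuarter (freq a ((k : ℤ) + 1)) - Real.log π) / 2 - 1 / (8 * ((k : ℝ) + 1))
        - a * (1 + weilArchDensity (2 * a)) / (π ^ 2 * ((k : ℝ) + 1) ^ 2)
        - (π / 2 - Real.arctan (Real.sqrt Bo / Real.sqrt ((k : ℝ) + 1))) / 2
        - a * (1 + weilArchDensity (2 * a)) / π ^ 2 * Real.sqrt (8 / Bo)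
        - A / 2
        - (Real.exp (a / 2) - Real.exp (-(a / 2))) ^ 2 * a / (π ^ 2 * Bo))
    (Λ1o : Fin ro → Fin Bo → ℝ) (Λ2o : Fin ro → Fin ro → ℝ)
    {ιo : Type*} [Fintype ιo] (φo : ιo → ℕ → ℝ) (wo : ℕ → ℝ)
    (Prowo : ℕ → ιo → ℝ) (ρrowo : ℕ → ℝ) (hρrowo : ∀ k, 0 ≤ ρrowo k)
    (hrowo : ∀ m, m₀o ≤ m → ∀ k, k < Bo →
      |((gramCoeff a ((k + 1 : ℕ) : ℤ) ((m + 1 : ℕ) : ℤ) - gramCoeff a ((k + 1 : ℕ) : ℤ) (-((m + 1 : ℕ) : ℤ))) / 2)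
        - (-1 : ℝ) ^ (m + 1) * ∑ f, Prowo k f * φo f m| ≤ ρrowo k * wo m)
    (Pimgo : ℕ → ιo → ℝ) (ρimgo : ℕ → ℝ) (hρimgo : ∀ q, 0 ≤ ρimgo q)
    (himgo : ∀ m, m₀o ≤ m → ∀ q ∈ so,
      |(weilWindowSesq a ((Icc (-a) a).indicator fun x : ℝ ↦ ((x : ℂ)) ^ q) (chi a (m + 1))).im
        - (-1 : ℝ) ^ (m + 1) * ∑ f, Pimgo q f * φo f m| ≤ ρimgo q * wo m)
    (Rtabo : Fin ro → ιo → ℝ)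
    (hVo : ∀ m, m₀o ≤ m → ∀ j : Fin ro,
      (2 * (Yoshida1992.fourierCoeff a ((m + 1 : ℕ) : ℤ) ((Icc (-a) a).indicator fun x : ℝ ↦ ∑ q ∈ so, ((coefo j q : ℝ) : ℂ) * ((x : ℂ)) ^ q)).im / Real.sqrt (2 * a))
        = (-1 : ℝ) ^ (m + 1) * ∑ f, Rtabo j f * φo f m)
    (Ufino : (Fin Bo → ℝ) → (Fin ro → ℝ) → ℝ)
    (hfino : ∀ (x : Fin Bo → ℝ) (β : Fin ro → ℝ),
      ∑ m ∈ Ico Bo m₀o,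
        (∑ i : Fin Bo, ((gramCoeff a (((i : ℕ) : ℤ) + 1) ((m : ℤ) + 1) - gramCoeff a (((i : ℕ) : ℤ) + 1) (-((m : ℤ) + 1))) / 2) * x i
          + ∑ j, ((weilWindowSesq a ((Icc (-a) a).indicator (fun x : ℝ ↦ ∑ q ∈ so, ((coefo j q : ℝ) : ℂ) * ((x : ℂ)) ^ q)
              - proj a Bo ((Icc (-a) a).indicator fun x : ℝ ↦ ∑ q ∈ so, ((coefo j q : ℝ) : ℂ) * ((x : ℂ)) ^ q))
              (chiOdd a (m + 1))).im / Real.sqrt 2) * β j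
          - ∑ j, (2 * (Yoshida1992.fourierCoeff a ((m : ℤ) + 1) ((Icc (-a) a).indicator fun x : ℝ ↦ ∑ q ∈ so, ((coefo j q : ℝ) : ℂ) * ((x : ℂ)) ^ q)).im / Real.sqrt (2 * a))
              * (∑ i, Λ1o j i * x i + ∑ j', Λ2o j j' * β j')) ^ 2 / dod m ≤ Ufino x β)
    {Wo : ℝ} (hWo : ∀ N, ∑ m ∈ Ico m₀o N, wo m ^ 2 ≤ Wo)
    (Γo : (ιo → ℝ) → ℝ) (hΓo : ∀ (N : ℕ) (u : ιo → ℝ), ∑ m ∈ Ico m₀o N, (∑ f, u f * φo f m) ^ 2 ≤ Γo u)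
    {θo : ℝ} (hθo : 0 < θo)
    (Uqo : (Fin Bo → ℝ) → (Fin ro → ℝ) → ℝ)
    (hUqo' : ∀ (x : Fin Bo → ℝ) (β : Fin ro → ℝ),
      Ufino x β + ((1 + θo) * Γo (fun f ↦ ∑ i : Fin Bo, (Prowo i f - ∑ j, Rtabo j f * Λ1o j i) * x i
            + ∑ j', ((∑ q ∈ so, coefo j' q * Pimgo q f
                      - ∑ n ∈ Finset.Ico 0 Bo, (2 * (Yoshida1992.fourierCoeff a ((n : ℤ) + 1) ((Icc (-a) a).indicator fun x : ℝ ↦ ∑ q ∈ so, ((coefo j' q : ℝ) : ℂ) * ((x : ℂ)) ^ q)).im / Real.sqrt (2 * a)) * Prowo n f)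
                    - ∑ j, Rtabo j f * Λ2o j j') * β j')
          + (1 + 1 / θo) * (Wo * ((∑ i : Fin Bo, ρrowo i
                + ∑ j, (∑ q ∈ so, |coefo j q| * ρimgo q
                    + ∑ n ∈ Finset.Ico 0 Bo, |(2 * (Yoshida1992.fourierCoeff a ((n : ℤ) + 1) ((Icc (-a) a).indicator fun x : ℝ ↦ ∑ q ∈ so, ((coefo j q : ℝ) : ℂ) * ((x : ℂ)) ^ q)).im / Real.sqrt (2 * a))| * ρrowo n))
              * (∑ i : Fin Bo, ρrowo i * x i ^ 2
                + ∑ j, (∑ q ∈ so, |coefo j q| * ρimgo q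
                    + ∑ n ∈ Finset.Ico 0 Bo, |(2 * (Yoshida1992.fourierCoeff a ((n : ℤ) + 1) ((Icc (-a) a).indicator fun x : ℝ ↦ ∑ q ∈ so, ((coefo j q : ℝ) : ℂ) * ((x : ℂ)) ^ q)).im / Real.sqrt (2 * a))| * ρrowo n) * β j ^ 2)))) / d₁o
        ≤ Uqo x β)
    {δo : ℝ} (hδo : 0 < δo)
    (hSo : ∀ (x : Fin Bo → ℝ) (β : Fin ro → ℝ),
      δo * (∑ i, x i ^ 2 + ∑ j, β j ^ 2) ≤
        ((∑ i : Fin Bo, ∑ i' : Fin Bo, x i * x i' *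
            ((gramCoeff a (((i : ℕ) : ℤ) + 1) (((i' : ℕ) : ℤ) + 1)
              - gramCoeff a (((i : ℕ) : ℤ) + 1) (-((((i' : ℕ) : ℤ)) + 1))) / 2))
          + 2 * (∑ i : Fin Bo, ∑ j : Fin ro, x i * β j *
            ((weilWindowSesq a ((Icc (-a) a).indicator (fun x : ℝ ↦ ∑ q ∈ so, ((coefo j q : ℝ) : ℂ) * ((x : ℂ)) ^ q)
                - proj a Bo ((Icc (-a) a).indicator fun x : ℝ ↦ ∑ q ∈ so, ((coefo j q : ℝ) : ℂ) * ((x : ℂ)) ^ q))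
              (chiOdd a ((i : ℕ) + 1))).im / Real.sqrt 2))
          + (∑ j : Fin ro, ∑ j' : Fin ro, β j * β j' *
            (weilWindowSesq a ((Icc (-a) a).indicator (fun x : ℝ ↦ ∑ q ∈ so, ((coefo j q : ℝ) : ℂ) * ((x : ℂ)) ^ q)
                - proj a Bo ((Icc (-a) a).indicator fun x : ℝ ↦ ∑ q ∈ so, ((coefo j q : ℝ) : ℂ) * ((x : ℂ)) ^ q))
              ((Icc (-a) a).indicator (fun x : ℝ ↦ ∑ q ∈ so, ((coefo j' q : ℝ) : ℂ) * ((x : ℂ)) ^ q)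
                - proj a Bo ((Icc (-a) a).indicator fun x : ℝ ↦ ∑ q ∈ so, ((coefo j' q : ℝ) : ℂ) * ((x : ℂ)) ^ q))).re))
        - Uqo x β
        + 2 * ∑ j, (∑ i, Λ1o j i * x i + ∑ j', Λ2o j j' * β j') * (β j - ∑ j', (∑' n : ℕ, if Bo ≤ n then
                (2 * (Yoshida1992.fourierCoeff a ((n : ℤ) + 1) ((Icc (-a) a).indicator fun x : ℝ ↦ ∑ q ∈ so, ((coefo j q : ℝ) : ℂ) * ((x : ℂ)) ^ q)).im / Real.sqrt (2 * a)) *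
                (2 * (Yoshida1992.fourierCoeff a ((n : ℤ) + 1) ((Icc (-a) a).indicator fun x : ℝ ↦ ∑ q ∈ so, ((coefo j' q : ℝ) : ℂ) * ((x : ℂ)) ^ q)).im / Real.sqrt (2 * a))
                else 0) * β j')) :
    WeilPositivityOn a := by
  -- profile regularity / parity / boundary data
  have hfeC : ∀ j : Fin re, ContDiff ℝ 3 (fun x : ℝ ↦ ∑ q ∈ se, ((coefe j q : ℝ) : ℂ) * ((x : ℂ)) ^ q) := fun j ↦ poly_contDiff se (coefe j)
  have hfee : ∀ (j : Fin re) (x : ℝ), (fun x : ℝ ↦ ∑ q ∈ se, ((coefe j q : ℝ) : ℂ) * ((x : ℂ)) ^ q) (-x) = (fun x : ℝ ↦ ∑ q ∈ se, ((coefe j q : ℝ) : ℂ) * ((x : ℂ)) ^ q) x := fun j ↦ (poly_even_real se (coefe j) hse).1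
  have hfer : ∀ (j : Fin re) (x : ℝ), conj ((fun x : ℝ ↦ ∑ q ∈ se, ((coefe j q : ℝ) : ℂ) * ((x : ℂ)) ^ q) x) = (fun x : ℝ ↦ ∑ q ∈ se, ((coefe j q : ℝ) : ℂ) * ((x : ℂ)) ^ q) x := fun j ↦ (poly_even_real se (coefe j) hse).2
  have hfe1 : ∀ j : Fin re, deriv (fun x : ℝ ↦ ∑ q ∈ se, ((coefe j q : ℝ) : ℂ) * ((x : ℂ)) ^ q) (-a) = deriv (fun x : ℝ ↦ ∑ q ∈ se, ((coefe j q : ℝ) : ℂ) * ((x : ℂ)) ^ q) a :=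
    fun j ↦ deriv_poly_even_boundary a se (coefe j) hse (hbe j)
  have hfoC : ∀ j : Fin ro, ContDiff ℝ 3 (fun x : ℝ ↦ ∑ q ∈ so, ((coefo j q : ℝ) : ℂ) * ((x : ℂ)) ^ q) := fun j ↦ poly_contDiff so (coefo j)
  have hfoo : ∀ (j : Fin ro) (x : ℝ), (fun x : ℝ ↦ ∑ q ∈ so, ((coefo j q : ℝ) : ℂ) * ((x : ℂ)) ^ q) (-x) = -(fun x : ℝ ↦ ∑ q ∈ so, ((coefo j q : ℝ) : ℂ) * ((x : ℂ)) ^ q) x := fun j ↦ (poly_odd_real so (coefo j) hso).1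
  have hfor : ∀ (j : Fin ro) (x : ℝ), conj ((fun x : ℝ ↦ ∑ q ∈ so, ((coefo j q : ℝ) : ℂ) * ((x : ℂ)) ^ q) x) = (fun x : ℝ ↦ ∑ q ∈ so, ((coefo j q : ℝ) : ℂ) * ((x : ℂ)) ^ q) x := fun j ↦ (poly_odd_real so (coefo j) hso).2
  have hfoa : ∀ j : Fin ro, (fun x : ℝ ↦ ∑ q ∈ so, ((coefo j q : ℝ) : ℂ) * ((x : ℂ)) ^ q) a = 0 := fun j ↦ poly_odd_apply_self a so (coefo j) (hbo j)
  have hfo1 : ∀ j : Fin ro, deriv (fun x : ℝ ↦ ∑ q ∈ so, ((coefo j q : ℝ) : ℂ) * ((x : ℂ)) ^ q) (-a) = deriv (fun x : ℝ ↦ ∑ q ∈ so, ((coefo j q : ℝ) : ℂ) * ((x : ℂ)) ^ q) a :=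
    fun j ↦ WeilConverseWindow.deriv_neg_of_odd (hfoo j) a
  -- the two coupling majorants
  have hUqe : ∀ (N : ℕ) (x : Fin (Be + 1) → ℝ) (β : Fin re → ℝ),
      ∑ m ∈ Ico (Be + 1) N,
        (∑ i : Fin (Be + 1), (if (i : ℕ) = 0 then gramCoeff a 0 m else if m = 0 then gramCoeff a i 0
            else (gramCoeff a i m + gramCoeff a i (-(m : ℤ))) / 2) * x i
          + ∑ j, ((weilWindowSesq a ((Icc (-a) a).indicator (fun x : ℝ ↦ ∑ q ∈ se, ((coefe j q : ℝ) : ℂ) * ((x : ℂ)) ^ q)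
              - proj a Be ((Icc (-a) a).indicator fun x : ℝ ↦ ∑ q ∈ se, ((coefe j q : ℝ) : ℂ) * ((x : ℂ)) ^ q))
              (chiEven a m)).re / (if m = 0 then 1 else Real.sqrt 2)) * β j
          - ∑ j, ((if m = 0 then 1 else 2) * (Yoshida1992.fourierCoeff a m ((Icc (-a) a).indicator fun x : ℝ ↦ ∑ q ∈ se, ((coefe j q : ℝ) : ℂ) * ((x : ℂ)) ^ q)).re / Real.sqrt (2 * a))
              * (∑ i, Λ1e j i * x i + ∑ j', Λ2e j j' * β j')) ^ 2 / de m ≤ Uqe x β :=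
    fun N x β ↦ (cinf_hUq_even ha hBme se hse coefe φe we Prowe ρrowe hρrowe hrowe Pimge ρimge hρimge himge
      Rtabe hVe Λ1e Λ2e de (fun m hm ↦ hde₀.trans_le (hde m hm)) hde₁ hde₃ Ufine hfine hWe Γe hΓe hθe N x β).trans
      (hUqe' x β)
  have hUqo : ∀ (N : ℕ) (x : Fin Bo → ℝ) (β : Fin ro → ℝ),
      ∑ m ∈ Ico Bo N,
        (∑ i : Fin Bo, ((gramCoeff a (((i : ℕ) : ℤ) + 1) ((m : ℤ) + 1) - gramCoeff a (((i : ℕ) : ℤ) + 1) (-((m : ℤ) + 1))) / 2) * x i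
          + ∑ j, ((weilWindowSesq a ((Icc (-a) a).indicator (fun x : ℝ ↦ ∑ q ∈ so, ((coefo j q : ℝ) : ℂ) * ((x : ℂ)) ^ q)
              - proj a Bo ((Icc (-a) a).indicator fun x : ℝ ↦ ∑ q ∈ so, ((coefo j q : ℝ) : ℂ) * ((x : ℂ)) ^ q))
              (chiOdd a (m + 1))).im / Real.sqrt 2) * β j
          - ∑ j, (2 * (Yoshida1992.fourierCoeff a ((m : ℤ) + 1) ((Icc (-a) a).indicator fun x : ℝ ↦ ∑ q ∈ so, ((coefo j q : ℝ) : ℂ) * ((x : ℂ)) ^ q)).im / Real.sqrt (2 * a))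
              * (∑ i, Λ1o j i * x i + ∑ j', Λ2o j j' * β j')) ^ 2 / dod m ≤ Uqo x β :=
    fun N x β ↦ (cinf_hUq_odd ha hBmo so hso coefo φo wo Prowo ρrowo hρrowo hrowo Pimgo ρimgo hρimgo himgo
      Rtabo hVo Λ1o Λ2o dod (fun m hm ↦ hdo₀.trans_le (hdo m hm)) hdo₁ hdo₃ Ufino hfino hWo Γo hΓo hθo N x β).trans
      (hUqo' x β)
  exact weilPositivityOn_of_formatC_cinfBA ha hPA Be (fun j ↦ fun x : ℝ ↦ ∑ q ∈ se, ((coefe j q : ℝ) : ℂ) * ((x : ℂ)) ^ q) hfeC hfee hfer hfe1 de hde₀ hde hBe hdle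
    (fun x β j ↦ ∑ i, Λ1e j i * x i + ∑ j', Λ2e j j' * β j') (by positivity) (sum_abs_matrixMap_le Λ1e Λ2e)
    Uqe hUqe hδe hSe hBo (fun j ↦ fun x : ℝ ↦ ∑ q ∈ so, ((coefo j q : ℝ) : ℂ) * ((x : ℂ)) ^ q) hfoC hfoo hfor hfoa hfo1 dod hdo₀ hdo hdlo
    (fun x β j ↦ ∑ i, Λ1o j i * x i + ∑ j', Λ2o j j' * β j') (by positivity) (sum_abs_matrixMap_le Λ1o Λ2o)
    Uqo hUqo hδo hSo

end Summit.RiemannHypothesis.RiemannHypothesis.Theorems.WeilFormatC
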